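import Mathlib
import Summits.Ventures.LatticeQCDFlow.Scaling.SlabChainReplicaSum

/-!
# LatticeQCDFlow / Scaling — slab chains: THE LEADING COEFFICIENT OF THE TILTED COVARIANCE —
# file 7 (the assembly) of the slab-chain proof of (LC) at every separation

HONEST FRAMING: exact (Metropolis-corrected) sampling algorithms for lattice gauge theory;
figures of merit are autocorrelation/cost numbers at stated couplings and volumes; no
continuum-physics claim.

Venture `LatticeQCDFlow` (cell pub-lqcd), topic `Scaling`, FANOUT row 30 (lean-1) — OUR WORK (LEAD
LINE 230 (G3′): the general-separation leading-coefficient identity (LC), abstract form).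
**THE SLAB-CHAIN THEOREM** (`SlabChain.cov_tilt_jetEq`).  Let `L = n+1` cyclic heights carry
independent layer variables `η_h ~ μ` and vertical variables `v_h ~ μV`, tilted by
`e^{βC}`, `C = Σ_h a_h(η_h) + Σ_h s_h(η_h, v_h, η_{h+1})` (`Scaling/SlabKernel.lean`), with bounded
measurable data, and suppose the MOMENT HYPOTHESIS of order `g ≥ 1`: `∫ s_h(e,w,e')^m dμV(w)` is
constant in `(e,e')` for `m < g` and equals `c_{h,g} + g! ρ_h(e,e')` at `m = g`, where `ρ_h` is
bounded measurable with `∫ ρ_h(e,e') dμ(e) = 0 = ∫ ρ_h(e,e') dμ(e')`.  Then for bounded measurable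
`x, y : E → ℝ` and a height `τ` with `1 ≤ τ`, `2τ ≤ n` (the long arc is longer), the tilted
covariance `⟨x(η_0) y(η_τ)⟩_β − ⟨x(η_0)⟩_β ⟨y(η_τ)⟩_β` (`⟨F⟩_β = ∫F e^{βC} / ∫ e^{βC}`) equals
`b β^{gτ} + O(β^{gτ+1})` at `β = 0`, **`b = ∫ x(η_0) y(η_τ) ∏_{h<τ} ρ_h(η_h, η_{h+1}) dμ^{⊗L}`**
(a `JetEq (gτ+1)` in the tree's jet vocabulary).  Steps here: the replica integral `J(β)` of
`Scaling/SlabChainReplicaSum.lean` expands over subsets of slabs (`replicaJ_eq_sum`) and is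
`2bβ^{gτ} + O(β^{gτ+1})` (`replicaJ_sub_isBigO`: cut / short arc / many slabs); it is twice the
numerator `⟨xy⟩Z − ⟨x⟩⟨y⟩` written with tilted integrals (`two_mul_numerator_eq_replicaJ`, Fubini
and the replica swap); division by `Z² → 1` (`isBigO_div_sq_sub`).  READING for the cell: on the
`d`-torus with `a`-slabs this is the transfer-kernel proof that the truncated plaquette–plaquette
correlation at separation `t` starts at order `β^{4t}` with the tube coefficient, for every gauge
group meeting the moment hypothesis with `g = 4` (`U(1)`: sequel files).  Elementary; nothing is
cited as a fact; no `def`, no `sorry`.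
-/

noncomputable section

open MeasureTheory Filter Topology Asymptotics Finset
open scoped Nat
open Literature.MathematicalPhysics.QuantumFieldTheory (JetEq BddAt isBigO_pow_pow_of_le)
open Summit.Ventures.LatticeQCDFlow.Theory2.Tilted

namespace Summit.Ventures.LatticeQCDFlow.Theory2.SlabChain

variable {n : ℕ} {E V : Type*} [MeasurableSpace E] [MeasurableSpace V]
  (μ : Measure E) (μV : Measure V) [IsProbabilityMeasure μ] [IsProbabilityMeasure μV]
  {D : SlabChain n E V} {Ma Ms : ℝ} {g : ℕ} {c : Fin (n + 1) → ℕ → ℂ}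
  {ρ : Fin (n + 1) → E → E → ℂ} {Mρ : ℝ} {x y : E → ℝ} {Bx By : ℝ} {τ : Fin (n + 1)}
  (hD : D.Bounds Ma Ms) (hM : D.Moments μV g c ρ) (hg : 1 ≤ g)
  (hρm : ∀ h, Measurable (Function.uncurry (ρ h))) (hρb : ∀ h e e', ‖ρ h e e'‖ ≤ Mρ)
  (hρ₁ : ∀ h e', ∫ e, ρ h e e' ∂μ = 0) (hρ₂ : ∀ h e, ∫ e', ρ h e e' ∂μ = 0)
  (hxm : Measurable x) (hym : Measurable y) (hxb : ∀ e, |x e| ≤ Bx) (hyb : ∀ e, |y e| ≤ By)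

/-! ## 1. The replica integral expanded over subsets of slabs -/

include hD hxm hym hxb hyb in
/-- **`J(β) = Σ_S (∏_{h∉S} cpoly_h(β)²) ∫∫ R W ∏_{h∈S} T_h`.** [folklore] -/
theorem replicaJ_eq_sum (β : ℂ) :
    replicaJ D μ μV x y τ β = ∑ S ∈ (univ : Finset (Fin (n + 1))).powerset,
      (∏ h ∈ univ \ S, cpoly c g h β ^ 2) *
        ∫ q, (((x (q.1 0) - x (q.2 0)) * (y (q.1 τ) - y (q.2 τ)) : ℝ) : ℂ) *
          (D.layerWeight β q.1 * D.layerWeight β q.2) * ∏ h ∈ S, dT D μV c g β h q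
          ∂((Measure.pi fun _ : Fin (n + 1) => μ).prod (Measure.pi fun _ : Fin (n + 1) => μ)) := by
  unfold replicaJ
  have hpt : ∀ q : (Fin (n + 1) → E) × (Fin (n + 1) → E),
      (((x (q.1 0) - x (q.2 0)) * (y (q.1 τ) - y (q.2 τ)) : ℝ) : ℂ) *
        (D.layerWeight β q.1 * D.layerWeight β q.2) * (D.kernelProd μV β q.1 * D.kernelProd μV β q.2) =
      ∑ S ∈ (univ : Finset (Fin (n + 1))).powerset, (∏ h ∈ univ \ S, cpoly c g h β ^ 2) *
        ((((x (q.1 0) - x (q.2 0)) * (y (q.1 τ) - y (q.2 τ)) : ℝ) : ℂ) *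
          (D.layerWeight β q.1 * D.layerWeight β q.2) * ∏ h ∈ S, dT D μV c g β h q) := by
    intro q
    rw [kernelProd_mul_kernelProd_eq_sum (c := c) (g := g), mul_sum]
    exact sum_congr rfl fun S _ => by ring
  simp_rw [hpt]
  rw [integral_finsetSum]
  · exact sum_congr rfl fun S _ => integral_const_mul _ _
  · intro S _
    refine (Integrable.of_bound ?_ ((2 * Bx) * (2 * By) * Real.exp (‖β‖ * (2 * ((n + 1) * Ma))) *
      ∏ h ∈ S, (Real.exp (‖β‖ * Ms) * Real.exp (‖β‖ * Ms) + ‖cpoly c g h β‖ ^ 2))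
      (Eventually.of_forall fun q => ?_)).const_mul _
    · refine Measurable.aestronglyMeasurable ?_
      refine ((Complex.measurable_ofReal.comp ?_).mul
        (((measurable_layerWeight hD β).comp measurable_fst).mul
          ((measurable_layerWeight hD β).comp measurable_snd))).mul (measurable_prod_dT μV hD β _)
      exact ((hxm.comp ((measurable_pi_apply 0).comp measurable_fst)).sub
        (hxm.comp ((measurable_pi_apply 0).comp measurable_snd))).mul
        ((hym.comp ((measurable_pi_apply τ).comp measurable_fst)).sub
          (hym.comp ((measurable_pi_apply τ).comp measurable_snd)))
    · rw [norm_mul, norm_mul]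
      have hBx : 0 ≤ Bx := (abs_nonneg _).trans (hxb (q.1 0))
      have hBy : 0 ≤ By := (abs_nonneg _).trans (hyb (q.1 τ))
      have h4 : 0 ≤ (2 * Bx) * (2 * By) := mul_nonneg (by linarith) (by linarith)
      exact mul_le_mul (mul_le_mul (norm_replicaObs_le hxb hyb q) (norm_layerWeight_mul_le hD β q)
        (norm_nonneg _) h4) (norm_prod_dT_le μV hD β _ q) (norm_nonneg _)
        (mul_nonneg h4 (Real.exp_pos _).le)

omit [MeasurableSpace E] [MeasurableSpace V] [IsProbabilityMeasure μV] in
/-- The scalar prefactor `∏_{h∈T} cpoly_h(β)²` is differentiable, hence bounded near `0` and equal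
to its value at `0` up to `O(β)`. [folklore] -/
theorem cpolyProd_sub_isBigO (T : Finset (Fin (n + 1))) :
    BddAt (fun β => ∏ h ∈ T, cpoly c g h β ^ 2) ∧
      (fun β => ∏ h ∈ T, cpoly c g h β ^ 2 - ∏ h ∈ T, cpoly c g h 0 ^ 2) =O[𝓝 (0 : ℂ)]
        fun β => β ^ 1 := by
  have hd : Differentiable ℂ fun β => ∏ h ∈ T, cpoly c g h β ^ 2 := by
    refine Differentiable.fun_finsetProd fun h _ => ?_
    unfold cpoly
    fun_prop
  refine ⟨bddAt_of_continuous hd.continuous, ?_⟩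
  simpa using (hd 0).isBigO_sub

include hD hM hg hρm hρb hρ₁ hρ₂ hxm hym hxb hyb in
/-- **`J(β) − 2b β^{gτ} = O(β^{gτ+1})`.** [folklore] -/
theorem replicaJ_sub_isBigO (hτ1 : 1 ≤ τ.val) (hτ2 : 2 * τ.val ≤ n) :
    (fun β => replicaJ D μ μV x y τ β -
        2 * (∫ η, (x (η 0) : ℂ) * (y (η τ) : ℂ) * chainProd ρ (Iio τ) η
          ∂(Measure.pi fun _ : Fin (n + 1) => μ)) * β ^ (g * τ.val))
      =O[𝓝 (0 : ℂ)] fun β => β ^ (g * τ.val + 1) := by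
  haveI : Nonempty E := nonempty_of_prob μ
  obtain ⟨e₀⟩ := ‹Nonempty E›
  set ν2 := (Measure.pi fun _ : Fin (n + 1) => μ).prod (Measure.pi fun _ : Fin (n + 1) => μ)
    with hν2
  set b := ∫ η, (x (η 0) : ℂ) * (y (η τ) : ℂ) * chainProd ρ (Iio τ) η
    ∂(Measure.pi fun _ : Fin (n + 1) => μ) with hb
  set I : Finset (Fin (n + 1)) → ℂ → ℂ := fun S β =>
    ∫ q, (((x (q.1 0) - x (q.2 0)) * (y (q.1 τ) - y (q.2 τ)) : ℝ) : ℂ) *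
      (D.layerWeight β q.1 * D.layerWeight β q.2) * ∏ h ∈ S, dT D μV c g β h q ∂ν2 with hI
  set pref : Finset (Fin (n + 1)) → ℂ → ℂ := fun S β => ∏ h ∈ univ \ S, cpoly c g h β ^ 2
    with hpref
  have hJ : ∀ β, replicaJ D μ μV x y τ β =
      ∑ S ∈ (univ : Finset (Fin (n + 1))).powerset, pref S β * I S β :=
    fun β => replicaJ_eq_sum μ μV hD hxm hym hxb hyb β
  have hS₀ : Iio τ ∈ (univ : Finset (Fin (n + 1))).powerset := mem_powerset.2 (subset_univ _)
  -- the short arc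
  have hpref0 : ∀ S : Finset (Fin (n + 1)), ∏ h ∈ univ \ S, cpoly c g h 0 ^ 2 = 1 := fun S => by
    refine prod_eq_one fun h _ => ?_
    rw [cpoly_zero, c_zero_eq_one μV hM hg h e₀ e₀, one_pow]
  have hlead : (fun β => pref (Iio τ) β * I (Iio τ) β - 2 * b * β ^ (g * τ.val)) =O[𝓝 (0 : ℂ)]
      fun β => β ^ (g * τ.val + 1) := by
    have h1 : (fun β => I (Iio τ) β - 2 * b * β ^ (g * τ.val)) =O[𝓝 (0 : ℂ)]
        fun β => β ^ (g * τ.val + 1) :=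
      slabTerm_Iio_sub_isBigO μ μV hD hM hg hρm hρb hρ₁ hρ₂ hxm hym hxb hyb hτ1
    obtain ⟨_, hp⟩ := cpolyProd_sub_isBigO (c := c) (g := g) (univ \ Iio τ)
    have hp' : (fun β => pref (Iio τ) β - 1) =O[𝓝 (0 : ℂ)] fun β => β ^ 1 :=
      hp.congr_left fun β => by rw [hpref0]
    have hIb : (fun β => I (Iio τ) β) =O[𝓝 (0 : ℂ)] fun β => β ^ (g * τ.val) := by
      have h2 : (fun β : ℂ => 2 * b * β ^ (g * τ.val)) =O[𝓝 (0 : ℂ)] fun β => β ^ (g * τ.val) :=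
        isBigO_const_mul_self _ _ _
      have h3 := (h1.trans (isBigO_pow_pow_of_le (Nat.le_succ _))).add h2
      simpa using h3
    have h4 := (hp'.mul hIb).congr_right (g₂ := fun β => β ^ (g * τ.val + 1)) fun β => by ring
    exact (h4.add h1).congr_left fun β => by ring
  -- the other subsets
  have hrest : ∀ S ∈ ((univ : Finset (Fin (n + 1))).powerset).erase (Iio τ),
      (fun β => pref S β * I S β) =O[𝓝 (0 : ℂ)] fun β => β ^ (g * τ.val + 1) := by
    intro S hS
    have hne : S ≠ Iio τ := ne_of_mem_erase hS
    obtain ⟨hpb, _⟩ := cpolyProd_sub_isBigO (c := c) (g := g) (univ \ S)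
    rcases cut_or_eq_or_card hτ2 S with ⟨h₁, h₂, h₁S, h₂S, h₁τ, h₂τ⟩ | heq | hcard
    · have h0 : ∀ β, I S β = 0 := fun β =>
        integral_slabTerm_eq_zero_of_cut μ μV h₁S h₂S h₁τ h₂τ β
      refine IsBigO.of_bound 0 (Eventually.of_forall fun β => ?_)
      simp [h0]
    · exact absurd heq hne
    · have h := (show (fun β => pref S β) =O[𝓝 (0 : ℂ)] (fun _ => (1 : ℂ)) from hpb).mul
        (slabTerm_isBigO_of_card μ μV hD hM hg hρb hxb hyb hcard)
      exact h.congr_right fun β => one_mul _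
  have hsum := IsBigO.sum hrest
  refine (hsum.add hlead).congr_left fun β => ?_
  rw [hJ β, ← add_sum_erase _ _ hS₀]
  ring

/-! ## 2. Twice the numerator is the replica integral -/

include hD hxm hym hxb hyb in
/-- **`2 (⟨xy⟩Z − ⟨x⟩⟨y⟩) = J`** for the tilted integrals: Fubini turns the products of
single-replica integrals into replica integrals, and the replica swap symmetrises. [folklore] -/
theorem two_mul_numerator_eq_replicaJ (β : ℂ) :
    2 * (tilt ((Measure.pi fun _ : Fin (n + 1) => μ).prod (Measure.pi fun _ : Fin (n + 1) => μV))
          D.cost (fun ω => ((x (ω.1 0) * y (ω.1 τ) : ℝ) : ℂ)) β *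
        tilt ((Measure.pi fun _ : Fin (n + 1) => μ).prod (Measure.pi fun _ : Fin (n + 1) => μV))
          D.cost (fun _ => 1) β -
      tilt ((Measure.pi fun _ : Fin (n + 1) => μ).prod (Measure.pi fun _ : Fin (n + 1) => μV))
          D.cost (fun ω => (x (ω.1 0) : ℂ)) β *
        tilt ((Measure.pi fun _ : Fin (n + 1) => μ).prod (Measure.pi fun _ : Fin (n + 1) => μV))
          D.cost (fun ω => (y (ω.1 τ) : ℂ)) β) = replicaJ D μ μV x y τ β := by
  set νE := Measure.pi fun _ : Fin (n + 1) => μ with hνE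
  -- bounded measurable observables of the layers
  have hBx : 0 ≤ Bx := (abs_nonneg _).trans (hxb (Classical.choice (nonempty_of_prob μ)))
  have mXY : Measurable fun η : Fin (n + 1) → E => ((x (η 0) * y (η τ) : ℝ) : ℂ) :=
    Complex.measurable_ofReal.comp ((hxm.comp (measurable_pi_apply 0)).mul
      (hym.comp (measurable_pi_apply τ)))
  have mX : Measurable fun η : Fin (n + 1) → E => (x (η 0) : ℂ) :=
    Complex.measurable_ofReal.comp (hxm.comp (measurable_pi_apply 0))
  have mY : Measurable fun η : Fin (n + 1) → E => (y (η τ) : ℂ) :=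
    Complex.measurable_ofReal.comp (hym.comp (measurable_pi_apply τ))
  have bXY : ∀ η : Fin (n + 1) → E, ‖((x (η 0) * y (η τ) : ℝ) : ℂ)‖ ≤ Bx * By := fun η => by
    rw [Complex.norm_real, Real.norm_eq_abs, abs_mul]
    exact mul_le_mul (hxb _) (hyb _) (abs_nonneg _) hBx
  have bX : ∀ η : Fin (n + 1) → E, ‖(x (η 0) : ℂ)‖ ≤ Bx := fun η => by
    rw [Complex.norm_real, Real.norm_eq_abs]; exact hxb _
  have bY : ∀ η : Fin (n + 1) → E, ‖(y (η τ) : ℂ)‖ ≤ By := fun η => by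
    rw [Complex.norm_real, Real.norm_eq_abs]; exact hyb _
  have b1 : ∀ η : Fin (n + 1) → E, ‖(fun _ => (1 : ℂ)) η‖ ≤ 1 := fun _ => by simp
  rw [tilt_eq_integral_kernelProd μ μV hD mXY bXY β, tilt_eq_integral_kernelProd μ μV hD mX bX β,
    tilt_eq_integral_kernelProd μ μV hD mY bY β,
    tilt_eq_integral_kernelProd μ μV hD measurable_const b1 β]
  -- the weight `M = Φ 𝒦` and the replica integrands
  set M : (Fin (n + 1) → E) → ℂ := fun η => D.layerWeight β η * D.kernelProd μV β η with hM
  have mM : Measurable M := (measurable_layerWeight hD β).mul (measurable_kernelProd hD μV β)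
  set CM : ℝ := Real.exp (‖β‖ * ((n + 1) * Ma)) * Real.exp (‖β‖ * Ms) ^ (n + 1) with hCM
  have hCM0 : 0 ≤ CM := by rw [hCM]; positivity
  have bM : ∀ η, ‖M η‖ ≤ CM := fun η => by
    rw [hM, norm_mul]
    exact mul_le_mul (norm_layerWeight_le hD β η) (norm_kernelProd_le hD μV β η) (norm_nonneg _)
      (Real.exp_pos _).le
  have e1 : ∀ η : Fin (n + 1) → E, ((x (η 0) * y (η τ) : ℝ) : ℂ) * D.layerWeight β η *
      D.kernelProd μV β η = ((x (η 0) * y (η τ) : ℝ) : ℂ) * M η := fun η => by rw [hM]; ring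
  have e2 : ∀ η : Fin (n + 1) → E, (1 : ℂ) * D.layerWeight β η * D.kernelProd μV β η = M η :=
    fun η => by rw [hM]; ring
  have e3 : ∀ η : Fin (n + 1) → E, (x (η 0) : ℂ) * D.layerWeight β η * D.kernelProd μV β η =
      (x (η 0) : ℂ) * M η := fun η => by rw [hM]; ring
  have e4 : ∀ η : Fin (n + 1) → E, (y (η τ) : ℂ) * D.layerWeight β η * D.kernelProd μV β η =
      (y (η τ) : ℂ) * M η := fun η => by rw [hM]; ring
  simp_rw [e1, e2, e3, e4]
  have hJ : replicaJ D μ μV x y τ β =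
      ∫ q, (((x (q.1 0) - x (q.2 0)) * (y (q.1 τ) - y (q.2 τ)) : ℝ) : ℂ) * (M q.1 * M q.2)
        ∂(νE.prod νE) := by
    unfold replicaJ
    refine integral_congr_ae (Eventually.of_forall fun q => ?_)
    simp only [hM]
    ring
  rw [hJ]
  clear_value M
  rw [← integral_prod_mul (μ := νE) (ν := νE) (fun η => ((x (η 0) * y (η τ) : ℝ) : ℂ) * M η) M,
    ← integral_prod_mul (μ := νE) (ν := νE) (fun η => (x (η 0) : ℂ) * M η)
      (fun η => (y (η τ) : ℂ) * M η)]
  -- `G(q) = (x₁y₁ − x₁y₂) M₁ M₂`; the replica integrand is `G + G ∘ swap`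
  set G : (Fin (n + 1) → E) × (Fin (n + 1) → E) → ℂ :=
    fun q => (((x (q.1 0) * y (q.1 τ) : ℝ) : ℂ) - (x (q.1 0) : ℂ) * (y (q.2 τ) : ℂ)) *
      (M q.1 * M q.2) with hG
  have hBy : 0 ≤ By := (abs_nonneg _).trans (hyb (Classical.choice (nonempty_of_prob μ)))
  have mG : Measurable G :=
    (((mXY.comp measurable_fst)).sub ((mX.comp measurable_fst).mul
      (mY.comp measurable_snd))).mul ((mM.comp measurable_fst).mul (mM.comp measurable_snd))
  have hBxy : 0 ≤ Bx * By := mul_nonneg hBx hBy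
  have bG : ∀ q, ‖G q‖ ≤ (Bx * By + Bx * By) * (CM * CM) := fun q => by
    rw [hG]
    refine (norm_mul_le _ _).trans (mul_le_mul ?_ ?_ (norm_nonneg _) (add_nonneg hBxy hBxy))
    · refine (norm_sub_le _ _).trans (add_le_add (bXY q.1) ?_)
      exact (norm_mul_le _ _).trans (mul_le_mul (bX _) (bY _) (norm_nonneg _) hBx)
    · exact (norm_mul_le _ _).trans (mul_le_mul (bM _) (bM _) (norm_nonneg _) hCM0)
  have iG : Integrable G (νE.prod νE) :=
    Integrable.of_bound mG.aestronglyMeasurable _ (Eventually.of_forall bG)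
  have iGs : Integrable (fun q => G q.swap) (νE.prod νE) :=
    Integrable.of_bound (mG.comp measurable_swap).aestronglyMeasurable _
      (Eventually.of_forall fun q => bG q.swap)
  have i1 : Integrable (fun q : (Fin (n + 1) → E) × (Fin (n + 1) → E) =>
      ((x (q.1 0) * y (q.1 τ) : ℝ) : ℂ) * M q.1 * M q.2) (νE.prod νE) := by
    refine Integrable.of_bound (((mXY.comp measurable_fst).mul (mM.comp measurable_fst)).mul
      (mM.comp measurable_snd)).aestronglyMeasurable (Bx * By * CM * CM)
      (Eventually.of_forall fun q => ?_)
    refine (norm_mul_le _ _).trans (mul_le_mul ?_ (bM _) (norm_nonneg _)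
      (mul_nonneg hBxy hCM0))
    exact (norm_mul_le _ _).trans (mul_le_mul (bXY _) (bM _) (norm_nonneg _) hBxy)
  have i2 : Integrable (fun q : (Fin (n + 1) → E) × (Fin (n + 1) → E) =>
      (x (q.1 0) : ℂ) * M q.1 * ((y (q.2 τ) : ℂ) * M q.2)) (νE.prod νE) := by
    refine Integrable.of_bound (((mX.comp measurable_fst).mul (mM.comp measurable_fst)).mul
      ((mY.comp measurable_snd).mul (mM.comp measurable_snd))).aestronglyMeasurable
      (Bx * CM * (By * CM)) (Eventually.of_forall fun q => ?_)
    refine (norm_mul_le _ _).trans (mul_le_mul ?_ ?_ (norm_nonneg _) (mul_nonneg hBx hCM0))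
    · exact (norm_mul_le _ _).trans (mul_le_mul (bX _) (bM _) (norm_nonneg _) hBx)
    · exact (norm_mul_le _ _).trans (mul_le_mul (bY _) (bM _) (norm_nonneg _) hBy)
  have hsub : (∫ q, ((x (q.1 0) * y (q.1 τ) : ℝ) : ℂ) * M q.1 * M q.2 ∂(νE.prod νE)) -
      ∫ q, (x (q.1 0) : ℂ) * M q.1 * ((y (q.2 τ) : ℂ) * M q.2) ∂(νE.prod νE) =
      ∫ q, G q ∂(νE.prod νE) := by
    rw [← integral_sub i1 i2]
    refine integral_congr_ae (Eventually.of_forall fun q => ?_)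
    simp only [hG]
    ring
  have hJ' : ∫ q, (((x (q.1 0) - x (q.2 0)) * (y (q.1 τ) - y (q.2 τ)) : ℝ) : ℂ) * (M q.1 * M q.2)
      ∂(νE.prod νE) = ∫ q, (G q + G q.swap) ∂(νE.prod νE) := by
    refine integral_congr_ae (Eventually.of_forall fun q => ?_)
    simp only [hG, Prod.fst_swap, Prod.snd_swap]
    push_cast
    ring
  rw [hsub, hJ', integral_add iG iGs, integral_prod_swap G]
  ring

/-! ## 3. The slab-chain theorem -/

include hD hM hg hρm hρb hρ₁ hρ₂ hxm hym hxb hyb in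
/-- **THE SLAB-CHAIN THEOREM (leading coefficient of the tilted covariance).**  Under the bounds,
the moment hypothesis of order `g ≥ 1`, vanishing marginals of `ρ`, bounded measurable `x, y`, and
`1 ≤ τ`, `2τ ≤ n`:  `⟨x(η_0) y(η_τ)⟩_β − ⟨x(η_0)⟩_β⟨y(η_τ)⟩_β = b β^{gτ} + O(β^{gτ+1})` at `β = 0`
with `b = ∫ x(η_0) y(η_τ) ∏_{h<τ} ρ_h(η_h, η_{h+1}) dμ^{⊗(n+1)}`, where `⟨F⟩_β` is the expectation
tilted by `e^{βC}`, `C = Σ_h a_h(η_h) + Σ_h s_h(η_h, v_h, η_{h+1})`. [folklore] -/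
theorem cov_tilt_jetEq (hτ1 : 1 ≤ τ.val) (hτ2 : 2 * τ.val ≤ n) :
    JetEq (g * τ.val + 1)
      (fun β =>
        tilt ((Measure.pi fun _ : Fin (n + 1) => μ).prod (Measure.pi fun _ : Fin (n + 1) => μV))
            D.cost (fun ω => ((x (ω.1 0) * y (ω.1 τ) : ℝ) : ℂ)) β /
          tilt ((Measure.pi fun _ : Fin (n + 1) => μ).prod (Measure.pi fun _ : Fin (n + 1) => μV))
            D.cost (fun _ => 1) β -
        tilt ((Measure.pi fun _ : Fin (n + 1) => μ).prod (Measure.pi fun _ : Fin (n + 1) => μV))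
            D.cost (fun ω => (x (ω.1 0) : ℂ)) β /
          tilt ((Measure.pi fun _ : Fin (n + 1) => μ).prod (Measure.pi fun _ : Fin (n + 1) => μV))
            D.cost (fun _ => 1) β *
        (tilt ((Measure.pi fun _ : Fin (n + 1) => μ).prod (Measure.pi fun _ : Fin (n + 1) => μV))
            D.cost (fun ω => (y (ω.1 τ) : ℂ)) β /
          tilt ((Measure.pi fun _ : Fin (n + 1) => μ).prod (Measure.pi fun _ : Fin (n + 1) => μV))
            D.cost (fun _ => 1) β))
      (fun β => (∫ η, (x (η 0) : ℂ) * (y (η τ) : ℂ) * chainProd ρ (Iio τ) η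
          ∂(Measure.pi fun _ : Fin (n + 1) => μ)) * β ^ (g * τ.val)) := by
  set νΩ := (Measure.pi fun _ : Fin (n + 1) => μ).prod (Measure.pi fun _ : Fin (n + 1) => μV)
    with hνΩ
  set b := ∫ η, (x (η 0) : ℂ) * (y (η τ) : ℂ) * chainProd ρ (Iio τ) η
    ∂(Measure.pi fun _ : Fin (n + 1) => μ) with hb
  set Z : ℂ → ℂ := tilt νΩ D.cost (fun _ => 1) with hZ
  set N : ℂ → ℂ := fun β => tilt νΩ D.cost (fun ω => ((x (ω.1 0) * y (ω.1 τ) : ℝ) : ℂ)) β * Z β -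
    tilt νΩ D.cost (fun ω => (x (ω.1 0) : ℂ)) β * tilt νΩ D.cost (fun ω => (y (ω.1 τ) : ℂ)) β
    with hN
  -- the cost is bounded and measurable
  have hCm : Measurable D.cost := measurable_cost hD
  have hCb : ∀ ω, |D.cost ω| ≤ (n + 1) * (Ma + Ms) := abs_cost_le hD
  have hM0 : (0 : ℝ) ≤ (n + 1) * (Ma + Ms) := by
    have := hD.Ma_nonneg; have := hD.Ms_nonneg; positivity
  -- the numerator
  have hNJ : ∀ β, N β = replicaJ D μ μV x y τ β / 2 := fun β => by
    rw [← two_mul_numerator_eq_replicaJ μ μV hD hxm hym hxb hyb β]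
    ring
  have hNb : (fun β => N β - b * β ^ (g * τ.val)) =O[𝓝 (0 : ℂ)] fun β => β ^ (g * τ.val + 1) := by
    have h := (replicaJ_sub_isBigO μ μV hD hM hg hρm hρb hρ₁ hρ₂ hxm hym hxb hyb hτ1 hτ2).const_mul_left
      (2⁻¹ : ℂ)
    refine h.congr_left fun β => ?_
    rw [hNJ β]
    ring
  -- the normaliser
  have hZ1 : (fun β => Z β - 1) =O[𝓝 (0 : ℂ)] fun β => β ^ 1 := by
    have hj := tilt_jetEq (ν := νΩ) (F := fun _ => (1 : ℂ)) (K := 1) hCm hCb hM0 measurable_const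
      (fun _ => by simp) one_pos
    have hpoly : tiltPoly νΩ D.cost (fun _ => (1 : ℂ)) 1 = fun _ => 1 := by
      funext β
      simp [tiltPoly, cmoment_one_zero]
    rw [JetEq, hpoly] at hj
    exact hj
  have hZinv : BddAt fun β => (Z β)⁻¹ := bddAt_inv_tilt_one (ν := νΩ) hCm hCb hM0
  have hZne : ∀ᶠ β in 𝓝 (0 : ℂ), Z β ≠ 0 := eventually_tilt_one_ne_zero (ν := νΩ) hCm hCb hM0
  have hmain := isBigO_div_sq_sub hNb hZ1 hZinv hZne
  refine hmain.congr_left fun β => ?_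
  -- the covariance is `N / Z²`, also when `Z = 0` (all divisions by zero vanish)
  simp only [hN, hZ]
  by_cases h0 : tilt νΩ D.cost (fun _ => (1 : ℂ)) β = 0
  · simp [h0]
  · field_simp

end Summit.Ventures.LatticeQCDFlow.Theory2.SlabChain

end
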